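import Literature.NumberTheory.EllipticCurves.CanonicalPAdicHeightParallelogramReductionProofs
import Literature.NumberTheory.EllipticCurves.CanonicalPAdicHeightThetaFormalProofs
import Literature.NumberTheory.EllipticCurves.PadicSigmaExistenceProofs
import HarnessLib

/-!
# `canonicalPAdicHeight_parallelogram` holds — the parallelogram law of the `p`-adic sigma
# height formula (Mazur–Stein–Tate 2006, §2.7; proofs only)

Trunk T-NT-EC (Literature/NumberTheory/EllipticCurves). Discharge of the tree's named fact
`WeierstrassCurve.canonicalPAdicHeight_parallelogram` (`CanonicalPAdicHeightProofs.lean`;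
Mazur–Stein–Tate, *Computation of `p`-adic heights and log convergence*, Doc. Math. Extra Vol.
Coates (2006), §2.7: for `W/ℚ` globally minimal, `p ≥ 5` good ordinary and `P, Q ∈ E(ℚ)` in the
admissible locus with `P ≠ ±Q`, the sigma formula `ĥ_p(R) = log_p(den x(R)) - 2 log_p σ_p(z(R))`
satisfies `ĥ_p(P + Q) + ĥ_p(P - Q) = 2ĥ_p(P) + 2ĥ_p(Q)` — "`h_ρ` is quadratic because of
property IV of `σ` in [MT91]"), and, on the way, of the named fact `WeierstrassCurve.padicSigma_theta`
(the Mazur–Tate theta relation of `σ_p` at rational points of the kernel of reduction).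

The printed argument is carried by the tree in three layers, all now theorems:

* the parallelogram law from the theta relation `padicSigma_theta` and Néron's denominator law
  (`canonicalPAdicHeight_parallelogram_of_padicSigma_theta`,
  `CanonicalPAdicHeightParallelogramReductionProofs`; denominators:
  `padicValNat_den_parallelogram_holds`);
* the theta relation at points from (θ₁) the EXISTENCE of the Mazur–Tate pair, (θ₂) the formal
  theta identity `padicSigma_theta_formal` (Blakestad–Grant 2023, Prop. 14) and (θ₃) the
  evaluation of the formal group law at points (`padicSigma_theta_of_MT_theta`,
  `FormalGroupLawPadicProofs`; θ₂ = `padicSigma_theta_formal_holds`,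
  `CanonicalPAdicHeightThetaFormalProofs`; θ₃ = `formalGroupLaw_padicEval_holds`);
* θ₁ = Mazur–Stein–Tate 2006, Thm. 1.3 / Mazur–Tate 1991, Thm. 3.1, i.e. the named fact
  `mazur_tate_sigma_existsUnique`, discharged by `mazur_tate_sigma_existsUnique_holds`
  (`PadicSigmaExistenceProofs`: Blakestad–Grant 2023, Thm. 1 — the integrality of the universal
  `p`-adic sigma function via the canonical `p`-isogeny and Hazewinkel's functional equation
  lemma — assembled over the universal ordinary ring `R̂`).

* `WeierstrassCurve.padicSigma_theta_holds` — the theta relation (named fact `padicSigma_theta`);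
* **`WeierstrassCurve.canonicalPAdicHeight_parallelogram_holds`** — the parallelogram law
  (named fact `canonicalPAdicHeight_parallelogram`).

## Sources

* B. Mazur, W. Stein, J. Tate, *Computation of `p`-adic heights and log convergence*, Doc. Math.
  Extra Vol. Coates (2006): Thm. 1.3 (p. 3, "proved in [MT91]"), §2.7 (p. 10, "`h_ρ` is
  quadratic because of property IV of `σ` in [MT91] … see also property III").
  [MazurSteinTate2006]
* B. Mazur, J. Tate, *The `p`-adic sigma function*, Duke Math. J. 62 (1991), Thm. 3.1
  (properties III–IV of `σ`). [MazurTate1991]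
* C. Blakestad, D. Grant, *On the universal `p`-adic sigma and Weierstrass zeta functions*,
  J. Number Theory 249 (2023) 348–376 (arXiv:1903.02480), Thm. 1, Prop. 14, Thm. 15.
  [BlakestadGrant2023]

Pure proof file: no definitions, no named facts; two discharges.
-/

noncomputable section

namespace WeierstrassCurve

/-- **The Mazur–Tate theta relation of `σ_p` at rational points of the kernel of reduction holds**
(named fact `padicSigma_theta`): `σ_p(z(P+Q))·σ_p(z(P-Q)) = (x₂ - x₁)·σ_p(z(P))²·σ_p(z(Q))²`
for `W/ℚ` globally minimal, `p ≥ 5` good ordinary, `P = (x₁,y₁)`, `Q = (x₂,y₂)` with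
`‖xᵢ‖_p > 1`, `x₁ ≠ x₂` — from the existence of the Mazur–Tate pair
(`mazur_tate_sigma_existsUnique_holds`), the formal theta identity
(`padicSigma_theta_formal_holds`, Blakestad–Grant 2023 Prop. 14) and the evaluation of the formal
group law at points. [Blakestad–Grant 2023, §3 and Prop. 14; Mazur–Tate 1991, Thm. 3.1 (IV);
Mazur–Stein–Tate 2006, §2.7] [cite: BlakestadGrant2023, Prop. 14] -/
theorem padicSigma_theta_holds : padicSigma_theta :=
  padicSigma_theta_of_MT_theta mazur_tate_sigma_existsUnique_holds padicSigma_theta_formal_holds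

/-- **Mazur–Stein–Tate 2006, §2.7: the `p`-adic sigma height formula satisfies the parallelogram
law** (named fact `canonicalPAdicHeight_parallelogram`): for `W/ℚ` globally minimal, `p ≥ 5` a
prime of good ordinary reduction, and `P, Q ∈ E(ℚ)` satisfying the local conditions with
`P - Q ≠ O`, `P + Q ≠ O`,
`ĥ_p(P + Q) + ĥ_p(P - Q) = 2ĥ_p(P) + 2ĥ_p(Q)` for `ĥ_p = canonicalPAdicHeight`
("`h_ρ` is quadratic because of property IV of `σ` in [MT91]"). Proof: the tree's reduction to
the theta relation of `σ_p` and Néron's denominator law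
(`canonicalPAdicHeight_parallelogram_of_MT_theta`), fed with `mazur_tate_sigma_existsUnique_holds`
(MST Thm. 1.3, via Blakestad–Grant 2023 Thm. 1) and `padicSigma_theta_formal_holds`.
[Mazur–Stein–Tate 2006, §2.7, Thm. 1.3; Mazur–Tate 1991, Thm. 3.1] [cite: MazurSteinTate2006, §2.7] -/
theorem canonicalPAdicHeight_parallelogram_holds : canonicalPAdicHeight_parallelogram :=
  canonicalPAdicHeight_parallelogram_of_MT_theta mazur_tate_sigma_existsUnique_holds
    padicSigma_theta_formal_holds

end WeierstrassCurve
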